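import Mathlib.Data.Fin.Tuple.Sort
import Summits.ValiantsHypothesis.ValiantsHypothesis.Theorems.GrenetZeonDualUnipotentThreeHalvesSlowCoreLedger
import Summits.ValiantsHypothesis.ValiantsHypothesis.Theorems.GrenetZeonDualUnipotentThreeHalvesHeavyTopFourSixTriangularisable
import Summits.ValiantsHypothesis.ValiantsHypothesis.Theorems.GrenetZeonDualUnipotentThreeHalvesHeavyTopPatternDefs

/-!
# `GrenetZeon.DualUnipotentThreeHalves` (stmt-ValiantsHypothesis-24318), MASS-CUT line `slow_core`, stub `stub_longMassSlowLawInv` ((c) `SlowCore.LongMassSlowLawInv`): ROWS r1 + r2 in `SlowCore.RelCert` currency — the FLAG MOVE as a certified ledger provider and the TRIANGULARISABLE LOCUS priced at `c = 3` (part 1/2; val-idea-26 g6, ported by name)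

§1 `relCert_mono` over ✓ `SlowCore.RelCert`.
§2 ★ r1 THE FLAG MOVE `ledger_of_flagAdapted` / `relCert_of_flagAdapted`: if along every line of `K` the substituted pencil is `FlagAdaptedUpTo m k n`
   (a constant change of basis + a level function with budget `flagDeg ≤ k`, ✓ `…WordDefs`), then `Ledger n m N ⊤ K k`, hence `RelCert n m N P` for
   every `P ≥ n·k + codim K`; `relCert_of_flagCheap`: `FlagCheap` is exactly a `RelCert` of price `P` with `P + n < n²`.
§3 ★ r1/r2 THE TRIANGULARISABLE ROW `flagAdapted_of_triangularisable`, `relCert_of_triangularisable`: if a CONSTANT invertible `P` makes `P·N·P⁻¹` strictly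
   upper triangular, then for EVERY block size `h ≥ 1`: `RelCert n m N (n·⌊(m−1)/h⌋ + ⌊m(h−1)/2⌋)` (Lemma D♯'s certificate, ✓ `flagCheap_of_triangularisable_sharp`,
   with the threshold hypothesis removed and the price recorded); `price_sqrt_le`; normal form `relCert_of_triangularisable_sqrt`: `RelCert n m N (3·(⌊√n⌋·m))`
   — (c) HOLDS with `c = 3`, `n₀ = 0`, on the whole simultaneously-triangularisable locus; `relCert_of_strictUpper` (the case `P = 1`).
§4 ★ r2 VALUE-SPACE FORM `relCert_of_values_triangularisable`, `relCert_of_valueSpace_triangularisable` (every VALUE `N(x)` in one triangularisable set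
   of matrices ⇒ the same price; ✓ `MvPolynomial.funext`).
§5 `longMass_on_triangularisable_locus` — the same in the binder shape of the research stub.  Part 2/2 (`…LongMassAcyclic`): row r7 (acyclic support).

WORDS OF RECORD (desk #377 (B) / #380, critic of record val-idea-crit-7 g3 V27/V35): «(c)-price HOLDS on the value-space-triangularisable locus (≤ 3·√n·b)
and on the acyclic-support locus (≤ 3·√n·b, and crit-7's 20·√n·b form by name) — SUPPORT LEMMAS, V35 (α) corner; never an `IrreducibleInv` constituent;
NOT progress on (c) `LongMassSlowLawInv`, RESEARCH — OPEN».  Calibration rows (M-tier) that the registered skeleton's menu names; no law is asserted; nothing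
here is claimed new (Lemma D in a finer currency).  (c) / (b) for a > 0 / S3 `SlowPlane` / R2ᵖ / 24318 / 8062 OPEN; VP ≠ VNP is NOT proved.  0 sorry.
Port (val-lit-p3 g18, desk #379/#380 (G2)) of val-idea-26 g6's `Cruxes/DualUnipotentThreeHalves/TriangularRow.lean` REV 2.2 (sha16 25b9bb0eab33ca55, 453 l.,
0 sorry / 0 warnings) — bodies VERBATIM by name, namespace `…Cruxes.DualUnipotentThreeHalves.TriangularRow` → `…Theorems.GrenetZeon.TriangularRow`, split in two
files for the 400-line convention; lead val-port-2 (line `slow_core`).  Credit: mathematics and kernel proofs val-idea-26 g6; r7 typed signature val-idea-crit-7 g3;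
`Ledger`/`RelCert` vocabulary val-idea-26 g5 / val-port-2 g3 (✓ `…SlowCoreLedger`); Lemma D♯ val-port-2 g2.  Helper (`--supports stmt-ValiantsHypothesis-24318 --as helper`).
No instances, no notation, no named facts.
-/

set_option linter.dupNamespace false
set_option autoImplicit false

noncomputable section

namespace Summit.ValiantsHypothesis.ValiantsHypothesis.Theorems.GrenetZeon.TriangularRow

open MvPolynomial Matrix
open scoped BigOperators
open Summit.ValiantsHypothesis.ValiantsHypothesis.Cruxes.TwoDimCoefficients.DimTwoCases (AffMat IsAffine)
open Summit.ValiantsHypothesis.ValiantsHypothesis.Theorems.GrenetZeon.RadicalSplit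
  (lineSubst flagDeg FlagAdapted FlagAdaptedUpTo FlagCheap card_sameBlock_pairs_le patTop patPencil patTop_apply_of_ne isAffine_patPencil)
open Summit.ValiantsHypothesis.ValiantsHypothesis.Theorems.GrenetZeon.SlowCore
  (Slow SlowR totalDegree_pow_le_flagDeg_of_le Ledger RelCert finrank_dir_le)
open Summit.ValiantsHypothesis.ValiantsHypothesis.Theorems.GrenetZeon.FlagCost (conj_pow_eq totalDegree_conj_le)
open Summit.ValiantsHypothesis.ValiantsHypothesis.Theorems.DualUnipotentThreeHalvesNegative.FlagCost
  (coeff_aeval_line_eq_zero_of_two_le map_conj_algHom coeff_conj_apply top_map_aeval_line_eq_linPart)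

/-! ## §1 The ledger vocabulary = ✓ p680269 `SlowCore.Ledger` / `SlowCore.RelCert` BY NAME (rev 2; rev 1 carried δ-twins) -/

/-- Prices are monotone. -/
theorem relCert_mono {n m : ℕ} {N : AffMat n m} {P P' : ℕ} (h : RelCert n m N P) (hP : P ≤ P') : RelCert n m N P' := by
  obtain ⟨K, k, hK, hKP⟩ := h
  exact ⟨K, k, hK, hKP.trans hP⟩

/-! ## §2 Row r1 — the FLAG MOVE as a certified ledger provider -/

/-- ★ **THE FLAG MOVE.**  If along every line `x + s v`, `v ∈ K`, the substituted pencil is adapted — after a constant change of basis that may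
depend on the line — to a flag of budget `≤ k` (`FlagAdaptedUpTo m k n`, ✓ `…WordDefs`), then `(K, k)` is a whole-pencil ledger entry: EVERY power
`b ≤ n − 1` has entries of `s`-degree `≤ k` (✓ `SlowCore.totalDegree_pow_le_flagDeg_of_le` on the conjugated matrix, transported back by
✓ `FlagCost.conj_pow_eq` / `FlagCost.totalDegree_conj_le`).  The body of ✓ `slow_core.slowR_of_flagCheap` with the budget inequality stripped.
[this file; slow_core rev 1 E1 (val-port-2 g3); flag_cost S3a] -/
theorem ledger_of_flagAdapted {n m : ℕ} (N : AffMat n m) (K : Submodule ℂ (Fin n × Fin n → ℂ)) (k : ℕ)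
    (h : ∀ x v : Fin n × Fin n → ℂ, v ∈ K → FlagAdaptedUpTo m k n (N.map (lineSubst x v))) :
    Ledger n m N (fun _ => True) K k := by
  intro x v hv b hb i j _ _
  obtain ⟨g, lvl, p, r, a, hl, hk, hA⟩ := h x v hv
  set N' := N.map (lineSubst x v) with hN'
  set G : Matrix (Fin m) (Fin m) (MvPolynomial (Fin 1) ℂ) := (g : Matrix (Fin m) (Fin m) ℂ).map C with hG
  set G' : Matrix (Fin m) (Fin m) (MvPolynomial (Fin 1) ℂ) := (↑g⁻¹ : Matrix (Fin m) (Fin m) ℂ).map C with hG'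
  have hGG : G' * G = 1 := by
    rw [hG, hG', ← Matrix.map_mul, Units.inv_mul, Matrix.map_one _ C_0 C_1]
  have hdegA : ∀ a' b', (((G * N' * G') ^ b) a' b').totalDegree ≤ k := fun a' b' =>
    (totalDegree_pow_le_flagDeg_of_le lvl p r a n b hb hl _ hA a' b').trans hk
  have hconj : N' ^ b = G' * (G * N' * G') ^ b * G := (conj_pow_eq G G' N' hGG b).symm
  rw [hconj]
  exact totalDegree_conj_le (g : Matrix (Fin m) (Fin m) ℂ) (↑g⁻¹ : Matrix (Fin m) (Fin m) ℂ) ((G * N' * G') ^ b) hdegA i j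

/-- ★ **r1 `relCert_of_flagAdapted`.**  Flag data price themselves: `n·k + codim K ≤ P` ⇒ `RelCert n m N P`. [this file] -/
theorem relCert_of_flagAdapted {n m : ℕ} (N : AffMat n m) (K : Submodule ℂ (Fin n × Fin n → ℂ)) (k P : ℕ)
    (h : ∀ x v : Fin n × Fin n → ℂ, v ∈ K → FlagAdaptedUpTo m k n (N.map (lineSubst x v)))
    (hP : n * k + (n * n - Module.finrank ℂ K) ≤ P) : RelCert n m N P :=
  ⟨K, k, ledger_of_flagAdapted N K k h, hP⟩

/-- **The exchange rate.**  A flag-cheap pencil (✓ `…WordDefs.FlagCheap`: `(k+1)·n < dim K`) has a certificate of price `P` with `P + n < n²`.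
[this file; MassCut §1 `slowR_iff_ledger`] -/
theorem relCert_of_flagCheap {n m : ℕ} (N : AffMat n m) (h : FlagCheap n m N) :
    ∃ P : ℕ, P + n < n * n ∧ RelCert n m N P := by
  obtain ⟨K, k, hK, hdim⟩ := h
  have hle := finrank_dir_le n K
  refine ⟨n * k + (n * n - Module.finrank ℂ K), ?_, relCert_of_flagAdapted N K k _ hK le_rfl⟩
  have e : (k + 1) * n = n * k + n := by ring
  omega

/-! ## §3 Rows r1/r2 — the TRIANGULARISABLE locus is (c)-cheap with `c = 3` -/

/-- **Lemma D♯'s certificate, priced.**  If the constant invertible `P` makes `P·N·P⁻¹` strictly upper triangular, then for every block size `h ≥ 1`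
the direction space `K := {v : the conjugated tops P·N_lin(v)·P⁻¹ vanish inside the diagonal blocks of size h}` carries the CONSTANT flag `P` with
levels `(m−1−i)/h`, drop `0`, weight `1`, budget `(m−1)/h` along every line, and `codim K ≤ ⌊m(h−1)/2⌋`.  Proof = ✓ `flagCheap_of_triangularisable_sharp`
(val-port-2 g2; p615665's Lemma D with the sharp counts) minus its threshold hypothesis. [✓ …HeavyTopFourSixTriangularisable; this file] -/
theorem flagAdapted_of_triangularisable {n m : ℕ} (N : AffMat n m) (hN : IsAffine N)
    (P : (Matrix (Fin m) (Fin m) ℂ)ˣ)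
    (htri : ∀ i j : Fin m, j ≤ i →
      ((P : Matrix (Fin m) (Fin m) ℂ).map C * N * (↑P⁻¹ : Matrix (Fin m) (Fin m) ℂ).map C : AffMat n m) i j = 0)
    (h : ℕ) (hh : 1 ≤ h) :
    ∃ K : Submodule ℂ (Fin n × Fin n → ℂ),
      (∀ x v : Fin n × Fin n → ℂ, v ∈ K → FlagAdaptedUpTo m ((m - 1) / h) n (N.map (lineSubst x v))) ∧
      n * n ≤ Module.finrank ℂ K + m * (h - 1) / 2 := by
  classical
  -- block levels
  obtain ⟨lvl, hlvl⟩ : ∃ lvl : Fin m → ℕ, ∀ i, lvl i = (m - 1 - (i : ℕ)) / h := ⟨_, fun _ => rfl⟩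
  have hanti : ∀ i j : Fin m, i < j → lvl j ≤ lvl i := fun i j hij => by
    rw [hlvl, hlvl]; exact Nat.div_le_div_right (by omega)
  -- the conjugated linear part, as a linear map
  obtain ⟨f, hf⟩ : ∃ f : (Fin n × Fin n → ℂ) → Matrix (Fin m) (Fin m) ℂ, ∀ v,
      f v = (P : Matrix (Fin m) (Fin m) ℂ) *
        Matrix.of (fun i j => ∑ c, v c * coeff (Finsupp.single c 1) (N i j)) * (↑P⁻¹ : Matrix (Fin m) (Fin m) ℂ) :=
    ⟨_, fun _ => rfl⟩
  have hflin : IsLinearMap ℂ f := by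
    constructor
    · intro v w
      have e : (Matrix.of fun i j => ∑ c, (v + w) c * coeff (Finsupp.single c 1) (N i j)) =
          (Matrix.of fun i j => ∑ c, v c * coeff (Finsupp.single c 1) (N i j)) +
          Matrix.of fun i j => ∑ c, w c * coeff (Finsupp.single c 1) (N i j) := by
        ext i j; simp [Matrix.add_apply, add_mul, Finset.sum_add_distrib]
      rw [hf, hf, hf, e, Matrix.mul_add, Matrix.add_mul]
    · intro a v
      have e : (Matrix.of fun i j => ∑ c, (a • v) c * coeff (Finsupp.single c 1) (N i j)) =
          a • Matrix.of fun i j => ∑ c, v c * coeff (Finsupp.single c 1) (N i j) := by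
        ext i j; simp [Matrix.smul_apply, Finset.mul_sum, mul_assoc]
      rw [hf, hf, e, Matrix.mul_smul, Matrix.smul_mul]
  obtain ⟨T, hT⟩ : ∃ T : (Fin n × Fin n → ℂ) →ₗ[ℂ] Matrix (Fin m) (Fin m) ℂ, ∀ v,
      T v = (P : Matrix (Fin m) (Fin m) ℂ) *
        Matrix.of (fun i j => ∑ c, v c * coeff (Finsupp.single c 1) (N i j)) * (↑P⁻¹ : Matrix (Fin m) (Fin m) ℂ) :=
    ⟨IsLinearMap.mk' f hflin, fun v => by rw [IsLinearMap.mk'_apply, hf]⟩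
  -- the within-block entries of the conjugated linear part, as a linear map to coordinates
  obtain ⟨l, hl⟩ : ∃ l : (Fin n × Fin n → ℂ) → ({q : Fin m × Fin m // q.1 < q.2 ∧ lvl q.1 = lvl q.2} → ℂ),
      ∀ v q, l v q = T v q.1.1 q.1.2 := ⟨fun v q => T v q.1.1 q.1.2, fun _ _ => rfl⟩
  have hllin : IsLinearMap ℂ l := by
    constructor
    · intro v w; funext q; rw [Pi.add_apply, hl, hl, hl, map_add, Matrix.add_apply]
    · intro a v; funext q; rw [Pi.smul_apply, hl, hl, map_smul, Matrix.smul_apply, smul_eq_mul]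
  obtain ⟨L, hL⟩ : ∃ L : (Fin n × Fin n → ℂ) →ₗ[ℂ]
      ({q : Fin m × Fin m // q.1 < q.2 ∧ lvl q.1 = lvl q.2} → ℂ), ∀ v q, L v q = T v q.1.1 q.1.2 :=
    ⟨IsLinearMap.mk' l hllin, fun v q => by rw [IsLinearMap.mk'_apply, hl]⟩
  -- counting the within-block pairs EXACTLY (✓ `card_sameBlock_pairs_le`)
  have hcard : Fintype.card {q : Fin m × Fin m // q.1 < q.2 ∧ lvl q.1 = lvl q.2} ≤ m * (h - 1) / 2 :=
    card_sameBlock_pairs_le m h hh lvl hlvl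
  refine ⟨LinearMap.ker L, fun x v hv => ⟨P, lvl, (m - 1) / h + 1, 0, 0, fun i => ?_, ?_, ?_⟩, ?_⟩
  · -- levels are < p = (m-1)/h + 1
    rw [hlvl]; exact Nat.lt_succ_of_le (Nat.div_le_div_right (by omega))
  · -- the budget of the block flag is (m-1)/h
    simp [flagDeg]
  · -- adaptedness of `P · N(x + s v) · P⁻¹` to the block flag
    intro i j d hd
    have hij : i < j := by
      rcases lt_or_ge i j with hlt' | hle
      · exact hlt'
      · exfalso
        apply hd
        rw [← map_conj_algHom (lineSubst x v), Matrix.map_apply, htri i j hle, map_zero, coeff_zero]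
    have hcoeff := coeff_conj_apply (P : Matrix (Fin m) (Fin m) ℂ) (↑P⁻¹ : Matrix (Fin m) (Fin m) ℂ)
      (N.map (lineSubst x v)) d i j
    have htops : (N.map (lineSubst x v)).map (coeff (Finsupp.single (0 : Fin 1) 1)) =
        Matrix.of fun i j => ∑ c, v c * coeff (Finsupp.single c 1) (N i j) :=
      top_map_aeval_line_eq_linPart N hN x v
    have hji := hanti i j hij
    rcases Nat.lt_or_ge (d 0) 2 with hlt | hge
    · rcases Nat.lt_or_ge (d 0) 1 with h0 | h1
      · have hd0 : d 0 = 0 := by omega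
        rw [hd0]; omega
      · have hd1 : d 0 = 1 := by omega
        have hdeq : d = Finsupp.single 0 1 := Finsupp.ext fun t => by
          fin_cases t; simp [hd1]
        have htop : coeff d (((P : Matrix (Fin m) (Fin m) ℂ).map C * N.map (lineSubst x v) *
            (↑P⁻¹ : Matrix (Fin m) (Fin m) ℂ).map C : Matrix (Fin m) (Fin m) (MvPolynomial (Fin 1) ℂ)) i j) =
            T v i j := by
          rw [hcoeff, hdeq, htops, hT]
        have hne : lvl i ≠ lvl j := by
          intro he
          have h0 := congr_fun (LinearMap.mem_ker.mp hv) ⟨(i, j), hij, he⟩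
          rw [hL, Pi.zero_apply] at h0
          exact hd (htop.trans h0)
        have hlt' : lvl j < lvl i := lt_of_le_of_ne hji (Ne.symm hne)
        rw [hd1]; omega
    · exfalso
      apply hd
      rw [hcoeff]
      have hz : (N.map (lineSubst x v)).map (coeff d) = 0 := by
        ext a b
        simp only [Matrix.map_apply, Matrix.zero_apply]
        exact coeff_aeval_line_eq_zero_of_two_le _ (hN a b) x v d hge
      rw [hz, Matrix.mul_zero, Matrix.zero_mul, Matrix.zero_apply]
  · -- dimension count: dim K ≥ n² − #pairs ≥ n² − ⌊m(h−1)/2⌋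
    have h1 := LinearMap.finrank_range_add_finrank_ker L
    have h2 : Module.finrank ℂ (LinearMap.range L) ≤
        Fintype.card {q : Fin m × Fin m // q.1 < q.2 ∧ lvl q.1 = lvl q.2} := by
      have := Submodule.finrank_le (LinearMap.range L)
      rwa [Module.finrank_fintype_fun_eq_card] at this
    have h3 : Module.finrank ℂ (Fin n × Fin n → ℂ) = n * n := by
      rw [Module.finrank_fintype_fun_eq_card, Fintype.card_prod, Fintype.card_fin]
    omega

/-- ★ **THE TRIANGULARISABLE ROW, any block size.**  `P·N·P⁻¹` strictly upper triangular (constant `P`) ⇒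
`RelCert n m N (n·⌊(m−1)/h⌋ + ⌊m(h−1)/2⌋)` for every `h ≥ 1`.  Nilpotency and irreducibility are not used. [this file] -/
theorem relCert_of_triangularisable {n m : ℕ} (N : AffMat n m) (hN : IsAffine N)
    (P : (Matrix (Fin m) (Fin m) ℂ)ˣ)
    (htri : ∀ i j : Fin m, j ≤ i →
      ((P : Matrix (Fin m) (Fin m) ℂ).map C * N * (↑P⁻¹ : Matrix (Fin m) (Fin m) ℂ).map C : AffMat n m) i j = 0)
    (h : ℕ) (hh : 1 ≤ h) :
    RelCert n m N (n * ((m - 1) / h) + m * (h - 1) / 2) := by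
  obtain ⟨K, hK, hdim⟩ := flagAdapted_of_triangularisable N hN P htri h hh
  exact relCert_of_flagAdapted N K _ _ hK (by omega)

/-- Arithmetic of the normal form: with `a = ⌊√n⌋` (so `n < (a+1)²`), `n·⌊(m−1)/(a+1)⌋ + ⌊m·a/2⌋ ≤ 3·(a·m)`. -/
theorem price_sqrt_le (n m : ℕ) :
    n * ((m - 1) / (Nat.sqrt n + 1)) + m * (Nat.sqrt n + 1 - 1) / 2 ≤ 3 * (Nat.sqrt n * m) := by
  set a := Nat.sqrt n with ha
  have hn : n < (a + 1) * (a + 1) := Nat.lt_succ_sqrt n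
  set q := (m - 1) / (a + 1) with hq_def
  have hq : (a + 1) * q ≤ m - 1 := Nat.mul_div_le (m - 1) (a + 1)
  have e1 : a + 1 - 1 = a := by omega
  rw [e1]
  have hc : m * a = a * m := mul_comm _ _
  rcases Nat.eq_zero_or_pos a with ha0 | ha0
  · have hn0 : n = 0 := by rw [ha0] at hn; omega
    rw [hn0, ha0]; simp
  · have h1 : n * q ≤ (a + 1) * ((a + 1) * q) := by
      rw [← mul_assoc]; exact Nat.mul_le_mul_right q hn.le
    have h2 : (a + 1) * ((a + 1) * q) ≤ (a + 1) * (m - 1) := Nat.mul_le_mul_left _ hq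
    have h4 : (a + 1) * (m - 1) ≤ 2 * (a * m) := by
      rcases Nat.eq_zero_or_pos m with hm | hm
      · rw [hm]; simp
      · obtain ⟨m', rfl⟩ : ∃ m', m = m' + 1 := ⟨m - 1, by omega⟩
        rw [Nat.add_sub_cancel]
        nlinarith
    omega

/-- ★ **NORMAL FORM — (c) with `c = 3`, `n₀ = 0`, on the triangularisable locus.**  `P·N·P⁻¹` strictly upper triangular (constant `P`) ⇒
`RelCert n m N (3·(⌊√n⌋·m))` (block size `⌊√n⌋ + 1`).  This is `LongMassSlowLaw`'s / `LongMassSlowLawInv`'s conclusion verbatim for `B := N`,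
`b := m`, without their nilpotency / irreducibility hypotheses. [this file] -/
theorem relCert_of_triangularisable_sqrt {n m : ℕ} (N : AffMat n m) (hN : IsAffine N)
    (P : (Matrix (Fin m) (Fin m) ℂ)ˣ)
    (htri : ∀ i j : Fin m, j ≤ i →
      ((P : Matrix (Fin m) (Fin m) ℂ).map C * N * (↑P⁻¹ : Matrix (Fin m) (Fin m) ℂ).map C : AffMat n m) i j = 0) :
    RelCert n m N (3 * (Nat.sqrt n * m)) :=
  relCert_mono (relCert_of_triangularisable N hN P htri (Nat.sqrt n + 1) (Nat.succ_le_succ (Nat.zero_le _))) (price_sqrt_le n m)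

/-- **`P = 1`:** a strictly upper triangular affine pencil has price `≤ 3·⌊√n⌋·m` (and `≤ n⌊(m−1)/h⌋ + ⌊m(h−1)/2⌋` for every `h ≥ 1`). [this file] -/
theorem relCert_of_strictUpper {n m : ℕ} (N : AffMat n m) (hN : IsAffine N) (htri : ∀ i j : Fin m, j ≤ i → N i j = 0) :
    RelCert n m N (3 * (Nat.sqrt n * m)) := by
  refine relCert_of_triangularisable_sqrt N hN 1 (fun i j hji => ?_)
  rw [inv_one, Units.val_one, Matrix.map_one C C_0 C_1, Matrix.one_mul, Matrix.mul_one]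
  exact htri i j hji

/-! ## §4 Row r2 — VALUE-SPACE form: every pencil whose points lie in one triangularisable space is (c)-cheap -/

/-- ★ **r2.**  If every value `N(x)`, `x ∈ ℂ^{n×n}`, lies in a set `V` of matrices that ONE constant invertible `P` conjugates into the strictly
upper triangular matrices (e.g. `V` a simultaneously triangularisable nilpotent SPACE containing the constant part and the tops), then
`RelCert n m N (3·(⌊√n⌋·m))`: an entry of `P·N·P⁻¹` on or below the diagonal vanishes at every point, hence is the zero polynomial
(✓ `MvPolynomial.funext`; the step of ✓ `triangularisable_pencil_of_spaces`).  So the content of (c) lives on constituents whose value space is NOT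
simultaneously triangularisable. [this file; V27 §3 r2] -/
theorem relCert_of_values_triangularisable {n m : ℕ} (N : AffMat n m) (hN : IsAffine N)
    (V : Set (Matrix (Fin m) (Fin m) ℂ)) (hV : ∀ x : Fin n × Fin n → ℂ, N.map (MvPolynomial.eval x) ∈ V)
    (P : (Matrix (Fin m) (Fin m) ℂ)ˣ)
    (hP : ∀ A ∈ V, ∀ i j : Fin m, j ≤ i →
      ((P : Matrix (Fin m) (Fin m) ℂ) * A * (↑P⁻¹ : Matrix (Fin m) (Fin m) ℂ)) i j = 0) :
    RelCert n m N (3 * (Nat.sqrt n * m)) := by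
  refine relCert_of_triangularisable_sqrt N hN P (fun i j hji => ?_)
  apply MvPolynomial.funext
  intro x
  have h1 : MvPolynomial.eval x (((P : Matrix (Fin m) (Fin m) ℂ).map C * N *
      (↑P⁻¹ : Matrix (Fin m) (Fin m) ℂ).map C : AffMat n m) i j) =
      ((P : Matrix (Fin m) (Fin m) ℂ) * N.map (MvPolynomial.eval x) * (↑P⁻¹ : Matrix (Fin m) (Fin m) ℂ)) i j := by
    have hPC : ((P : Matrix (Fin m) (Fin m) ℂ).map C).map (MvPolynomial.eval x) = (P : Matrix (Fin m) (Fin m) ℂ) := by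
      rw [Matrix.map_map]; ext a b; simp
    have hQC : ((↑P⁻¹ : Matrix (Fin m) (Fin m) ℂ).map C).map (MvPolynomial.eval x) = (↑P⁻¹ : Matrix (Fin m) (Fin m) ℂ) := by
      rw [Matrix.map_map]; ext a b; simp
    rw [← Matrix.map_apply (f := MvPolynomial.eval x), Matrix.map_mul, Matrix.map_mul, hPC, hQC]
  rw [h1, map_zero]
  exact hP _ (hV x) i j hji

/-- The same with a SUBSPACE `V ≤ M_m(ℂ)` (the natural reading of «value space»). [this file] -/
theorem relCert_of_valueSpace_triangularisable {n m : ℕ} (N : AffMat n m) (hN : IsAffine N)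
    (V : Submodule ℂ (Matrix (Fin m) (Fin m) ℂ)) (hV : ∀ x : Fin n × Fin n → ℂ, N.map (MvPolynomial.eval x) ∈ V)
    (P : (Matrix (Fin m) (Fin m) ℂ)ˣ)
    (hP : ∀ A ∈ V, ∀ i j : Fin m, j ≤ i →
      ((P : Matrix (Fin m) (Fin m) ℂ) * A * (↑P⁻¹ : Matrix (Fin m) (Fin m) ℂ)) i j = 0) :
    RelCert n m N (3 * (Nat.sqrt n * m)) :=
  relCert_of_values_triangularisable N hN (V : Set (Matrix (Fin m) (Fin m) ℂ)) hV P (fun A hA => hP A hA)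

/-! ## §5 In the binder shape of the research stub -/

/-- **(c) ON THE TRIANGULARISABLE LOCUS**, in `LongMassSlowLaw`'s binder order with `c = 3`, `n₀ = 0` and the hypotheses `B ^ b = 0`,
`pencilAlg B = ⊤` / `IrreducibleInv B` replaced by simultaneous triangularisability (so it is NOT an instance of the stub — irreducible
constituents of size `b ≥ 2` are never triangularisable; it is the calibration V27 (R2) asked for: «an irreducible constituent is to be no
pricier than a triangular one, up to c»). [this file] -/
theorem longMass_on_triangularisable_locus :
    ∀ n b : ℕ, ∀ B : AffMat n b, IsAffine B →
      (∃ P : (Matrix (Fin b) (Fin b) ℂ)ˣ, ∀ i j : Fin b, j ≤ i →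
        ((P : Matrix (Fin b) (Fin b) ℂ).map C * B * (↑P⁻¹ : Matrix (Fin b) (Fin b) ℂ).map C : AffMat n b) i j = 0) →
      RelCert n b B (3 * (Nat.sqrt n * b)) := by
  intro n b B hB hP
  obtain ⟨P, htri⟩ := hP
  exact relCert_of_triangularisable_sqrt B hB P htri


end Summit.ValiantsHypothesis.ValiantsHypothesis.Theorems.GrenetZeon.TriangularRow

end
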